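import Mathlib.Analysis.SpecialFunctions.Complex.Circle
import Mathlib.Analysis.SpecialFunctions.Complex.CircleMap
import Mathlib.MeasureTheory.Integral.CircleIntegral
import Mathlib.Analysis.Convex.PathConnected
import Literature.Probability.RandomPlanarGeometry.CLE
import Literature.Probability.RandomPlanarGeometry.RestrictionConfigEvents
import HarnessLib

/-!
# Square loops and dyadic squares

Support file for the explicit Möbius-invariant loop ensemble discharging the named fact
`Literature.Probability.RandomPlanarGeometry.exists_isCLEFamily` (`CLE.lean`): the loops of that
ensemble are (conformal images of) the boundaries of the dyadic squares contained in the open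
standard fundamental domain of the modular group. This file is elementary plane geometry:

* `boxNorm z = max |re z| |im z|` (the sup norm of `ℂ ≅ ℝ²`), the closed / open square
  `sqSet c r`, `sqInt c r` of centre `c` and half-side `r` and its boundary `sqBdry c r`;
* the *unit square loop* `unitSquareLoop θ = e^{iθ} / boxNorm (e^{iθ})` (radial projection of the
  unit circle onto the unit sup-sphere): continuous, `2π`-periodic, injective on `[0, 2π)`, onto
  `{boxNorm = 1}`; the parametrised boundary `squareLoop c r : Curve ℂ` of a square, a simple loop
  (`isSimpleLoop_squareLoop`) with trace `sqBdry c r` (`range_squareLoop`);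
* a connected set meeting a closed square and its complement meets the boundary of the square
  (`exists_mem_sqBdry_of_isPreconnected`, intermediate value theorem for `boxNorm`);
* dyadic squares `[a 2⁻ᵏ, (a+1) 2⁻ᵏ] × [b 2⁻ᵏ, (b+1) 2⁻ᵏ]` (`dyCenter`, `dyRad`): two dyadic squares
  are nested or have disjoint interiors (`dySq_trichotomy`), and every point of an open set lies
  in arbitrarily small dyadic squares inside the set (`exists_dySq_subset`).

## Precedents in the tree (bridged, to be unified by a librarian)

* `boxNorm` is the same function as `Complex.boxNorm` of
  `Literature/Probability/LatticeModels/IsoradialPercolation.lean` (not imported here: a percolation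
  file); both are Mathlib's sup norm of `ℝ × ℝ` read through `Complex.equivRealProd`
  (`boxNorm_eq_norm_equivRealProd`).
* The closed dyadic square `sqSet (dyCenter k a b) (dyRad k)` *is* `dyadicSquare k a b` of
  `RestrictionConfigEvents.lean` (`sqSet_dyCenter_dyRad_eq`); the centre/half-side description is the
  one needed for the boundary loop `squareLoop` and for the open square / boundary, which
  `dyadicSquare` does not provide. `mem_dySq_floor` is `mem_dyadicSquare_floor` through the bridge.

## References

* S. Sheffield, *Exploration trees and conformal loop ensembles*, Duke Math. J. 147 (2009),
  §1.1 (the axioms that the ensemble built from these squares is shown to satisfy).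
* M. Aizenman, A. Burchard, Duke Math. J. 99 (1999), §2.1 (curves modulo reparametrisation).
-/

noncomputable section

open Set Filter Topology Complex Real

namespace Literature.Probability.RandomPlanarGeometry

/-! ### The sup norm of `ℂ ≅ ℝ²` -/

/-- The sup ("box") norm `max |re z| |im z|` on `ℂ ≅ ℝ²`; its spheres are boundaries of
axis-parallel squares. [folklore] -/
def boxNorm (z : ℂ) : ℝ := max |z.re| |z.im|

/-- Unfolding `boxNorm`. [folklore] -/
lemma boxNorm_def (z : ℂ) : boxNorm z = max |z.re| |z.im| := rfl

/-- `boxNorm` is Mathlib's sup norm of `ℝ × ℝ` transported by `Complex.equivRealProd` (and is the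
function `Complex.boxNorm` of `IsoradialPercolation.lean`). [folklore] -/
lemma boxNorm_eq_norm_equivRealProd (z : ℂ) : boxNorm z = ‖Complex.equivRealProd z‖ := by
  simp [boxNorm, Prod.norm_def, Real.norm_eq_abs]

/-- The box norm is non-negative. [folklore] -/
lemma boxNorm_nonneg (z : ℂ) : 0 ≤ boxNorm z := le_max_of_le_left (abs_nonneg _)

/-- `|re z| ≤ boxNorm z`. [folklore] -/
lemma abs_re_le_boxNorm (z : ℂ) : |z.re| ≤ boxNorm z := le_max_left _ _

/-- `|im z| ≤ boxNorm z`. [folklore] -/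
lemma abs_im_le_boxNorm (z : ℂ) : |z.im| ≤ boxNorm z := le_max_right _ _

/-- The box norm is dominated by the Euclidean norm. [folklore] -/
lemma boxNorm_le_norm (z : ℂ) : boxNorm z ≤ ‖z‖ :=
  max_le (abs_re_le_norm z) (abs_im_le_norm z)

/-- The Euclidean norm is at most twice the box norm. [folklore] -/
lemma norm_le_two_mul_boxNorm (z : ℂ) : ‖z‖ ≤ 2 * boxNorm z := by
  refine (norm_le_abs_re_add_abs_im z).trans ?_
  rw [two_mul]
  exact add_le_add (abs_re_le_boxNorm z) (abs_im_le_boxNorm z)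

/-- `boxNorm 0 = 0`. [folklore] -/
@[simp] lemma boxNorm_zero : boxNorm 0 = 0 := by simp [boxNorm]

/-- The box norm is symmetric. [folklore] -/
lemma boxNorm_neg (z : ℂ) : boxNorm (-z) = boxNorm z := by simp [boxNorm]

/-- `boxNorm (z - w) = boxNorm (w - z)`. [folklore] -/
lemma boxNorm_sub_comm (z w : ℂ) : boxNorm (z - w) = boxNorm (w - z) := by
  rw [← boxNorm_neg, neg_sub]

/-- The box norm is absolutely homogeneous for real scalars. [folklore] -/
lemma boxNorm_ofReal_mul (t : ℝ) (z : ℂ) : boxNorm (t * z) = |t| * boxNorm z := by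
  simp only [boxNorm, re_ofReal_mul, im_ofReal_mul, abs_mul]
  exact (mul_max_of_nonneg _ _ (abs_nonneg t)).symm

/-- The box norm vanishes only at `0`. [folklore] -/
lemma boxNorm_eq_zero {z : ℂ} : boxNorm z = 0 ↔ z = 0 := by
  refine ⟨fun h ↦ ?_, fun h ↦ by rw [h, boxNorm_zero]⟩
  have h1 : ‖z‖ ≤ 0 := by simpa [h] using norm_le_two_mul_boxNorm z
  exact norm_le_zero_iff.1 h1

/-- The box norm is continuous. [folklore] -/
@[fun_prop] lemma continuous_boxNorm : Continuous boxNorm :=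
  (continuous_abs.comp continuous_re).max (continuous_abs.comp continuous_im)

/-- A point of Euclidean norm one has positive box norm (indeed `≥ 1/2`). [folklore] -/
lemma boxNorm_pos_of_norm_eq_one {z : ℂ} (hz : ‖z‖ = 1) : 0 < boxNorm z := by
  have := norm_le_two_mul_boxNorm z
  rw [hz] at this
  linarith

/-! ### Squares -/

/-- The closed axis-parallel square of centre `c` and half-side `r`. [folklore] -/
def sqSet (c : ℂ) (r : ℝ) : Set ℂ := {z | boxNorm (z - c) ≤ r}

/-- The open axis-parallel square of centre `c` and half-side `r`. [folklore] -/
def sqInt (c : ℂ) (r : ℝ) : Set ℂ := {z | boxNorm (z - c) < r}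

/-- The boundary of the square of centre `c` and half-side `r` (the sup-norm sphere). [folklore] -/
def sqBdry (c : ℂ) (r : ℝ) : Set ℂ := {z | boxNorm (z - c) = r}

/-- Membership in `sqSet`. [folklore] -/
@[simp] lemma mem_sqSet {c z : ℂ} {r : ℝ} : z ∈ sqSet c r ↔ boxNorm (z - c) ≤ r := Iff.rfl

/-- Membership in `sqInt`. [folklore] -/
@[simp] lemma mem_sqInt {c z : ℂ} {r : ℝ} : z ∈ sqInt c r ↔ boxNorm (z - c) < r := Iff.rfl

/-- Membership in `sqBdry`. [folklore] -/
@[simp] lemma mem_sqBdry {c z : ℂ} {r : ℝ} : z ∈ sqBdry c r ↔ boxNorm (z - c) = r := Iff.rfl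

/-- Membership in a square in coordinates. [folklore] -/
lemma mem_sqSet_iff {c z : ℂ} {r : ℝ} :
    z ∈ sqSet c r ↔ |z.re - c.re| ≤ r ∧ |z.im - c.im| ≤ r := by
  simp [sqSet, boxNorm]

/-- Membership in an open square in coordinates. [folklore] -/
lemma mem_sqInt_iff {c z : ℂ} {r : ℝ} :
    z ∈ sqInt c r ↔ |z.re - c.re| < r ∧ |z.im - c.im| < r := by
  simp [sqInt, boxNorm]

/-- The boundary lies in the closed square. [folklore] -/
lemma sqBdry_subset_sqSet (c : ℂ) (r : ℝ) : sqBdry c r ⊆ sqSet c r :=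
  fun _ h ↦ mem_sqSet.2 (le_of_eq (mem_sqBdry.1 h))

/-- The open square lies in the closed square. [folklore] -/
lemma sqInt_subset_sqSet (c : ℂ) (r : ℝ) : sqInt c r ⊆ sqSet c r :=
  fun _ h ↦ mem_sqSet.2 (le_of_lt (mem_sqInt.1 h))

/-- A point of the closed square off the open square is on the boundary. [folklore] -/
lemma mem_sqBdry_of_mem_sqSet_of_not_mem_sqInt {c z : ℂ} {r : ℝ} (h : z ∈ sqSet c r)
    (h' : z ∉ sqInt c r) : z ∈ sqBdry c r :=
  le_antisymm h (not_lt.1 h')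

/-- The open square misses the boundary. [folklore] -/
lemma sqInt_inter_sqBdry (c : ℂ) (r : ℝ) : sqInt c r ∩ sqBdry c r = ∅ :=
  eq_empty_of_forall_notMem fun _ ⟨h1, h2⟩ ↦ (ne_of_lt (mem_sqInt.1 h1)) h2

/-- The centre lies in the open square of positive half-side. [folklore] -/
lemma center_mem_sqInt (c : ℂ) {r : ℝ} (hr : 0 < r) : c ∈ sqInt c r := by simp [hr]

/-- Closed squares are closed. [folklore] -/
lemma isClosed_sqSet (c : ℂ) (r : ℝ) : IsClosed (sqSet c r) :=
  isClosed_le (continuous_boxNorm.comp (continuous_id.sub continuous_const)) continuous_const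

/-- Open squares are open. [folklore] -/
lemma isOpen_sqInt (c : ℂ) (r : ℝ) : IsOpen (sqInt c r) :=
  isOpen_lt (continuous_boxNorm.comp (continuous_id.sub continuous_const)) continuous_const

/-- Square boundaries are closed. [folklore] -/
lemma isClosed_sqBdry (c : ℂ) (r : ℝ) : IsClosed (sqBdry c r) :=
  isClosed_eq (continuous_boxNorm.comp (continuous_id.sub continuous_const)) continuous_const

/-- Two points of a square are at distance at most `4 r`. [folklore] -/
lemma dist_le_of_mem_sqSet {c z w : ℂ} {r : ℝ} (hz : z ∈ sqSet c r) (hw : w ∈ sqSet c r) :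
    dist z w ≤ 4 * r := by
  rw [dist_eq_norm]
  have h1 : ‖z - w‖ ≤ ‖z - c‖ + ‖w - c‖ := by
    rw [← norm_neg (w - c)]
    exact (norm_add_le (z - c) (-(w - c))).trans_eq' (by ring_nf)
  have h2 := norm_le_two_mul_boxNorm (z - c)
  have h3 := norm_le_two_mul_boxNorm (w - c)
  have h4 : boxNorm (z - c) ≤ r := hz
  have h5 : boxNorm (w - c) ≤ r := hw
  linarith

/-- Closed squares are bounded. [folklore] -/
lemma isBounded_sqSet (c : ℂ) (r : ℝ) : Bornology.IsBounded (sqSet c r) :=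
  Metric.isBounded_iff.2 ⟨4 * r, fun _ hz _ hw ↦ dist_le_of_mem_sqSet hz hw⟩

/-- Closed squares are compact. [folklore] -/
lemma isCompact_sqSet (c : ℂ) (r : ℝ) : IsCompact (sqSet c r) :=
  Metric.isCompact_of_isClosed_isBounded (isClosed_sqSet c r) (isBounded_sqSet c r)

/-- The diameter of a square is at most `4 r` (`r ≥ 0`). [folklore] -/
lemma diam_sqSet_le (c : ℂ) {r : ℝ} (hr : 0 ≤ r) : Metric.diam (sqSet c r) ≤ 4 * r :=
  Metric.diam_le_of_forall_dist_le (by positivity) fun _ hz _ hw ↦ dist_le_of_mem_sqSet hz hw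

/-- Open squares are convex. [folklore] -/
lemma convex_sqInt (c : ℂ) (r : ℝ) : Convex ℝ (sqInt c r) := by
  have : sqInt c r = {z : ℂ | z.re < c.re + r} ∩ {z : ℂ | c.re - r < z.re} ∩
      ({z : ℂ | z.im < c.im + r} ∩ {z : ℂ | c.im - r < z.im}) := by
    ext z
    simp only [mem_sqInt_iff, abs_lt, mem_inter_iff, mem_setOf_eq]
    constructor
    · rintro ⟨⟨h1, h2⟩, h3, h4⟩; exact ⟨⟨by linarith, by linarith⟩, by linarith, by linarith⟩
    · rintro ⟨⟨h1, h2⟩, h3, h4⟩; exact ⟨⟨by linarith, by linarith⟩, by linarith, by linarith⟩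
  rw [this]
  exact ((convex_halfSpace_re_lt _).inter (convex_halfSpace_re_gt _)).inter
    ((convex_halfSpace_im_lt _).inter (convex_halfSpace_im_gt _))

/-- Closed squares are convex. [folklore] -/
lemma convex_sqSet (c : ℂ) (r : ℝ) : Convex ℝ (sqSet c r) := by
  have : sqSet c r = {z : ℂ | z.re ≤ c.re + r} ∩ {z : ℂ | c.re - r ≤ z.re} ∩
      ({z : ℂ | z.im ≤ c.im + r} ∩ {z : ℂ | c.im - r ≤ z.im}) := by
    ext z
    simp only [mem_sqSet_iff, abs_le, mem_inter_iff, mem_setOf_eq]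
    constructor
    · rintro ⟨⟨h1, h2⟩, h3, h4⟩; exact ⟨⟨by linarith, by linarith⟩, by linarith, by linarith⟩
    · rintro ⟨⟨h1, h2⟩, h3, h4⟩; exact ⟨⟨by linarith, by linarith⟩, by linarith, by linarith⟩
  rw [this]
  exact ((convex_halfSpace_re_le _).inter (convex_halfSpace_re_ge _)).inter
    ((convex_halfSpace_im_le _).inter (convex_halfSpace_im_ge _))

/-- Open squares are preconnected. [folklore] -/
lemma isPreconnected_sqInt (c : ℂ) (r : ℝ) : IsPreconnected (sqInt c r) :=
  (convex_sqInt c r).isPreconnected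

/-- Radial points `c + t (z - c)` of a square: their box distance to the centre. [folklore] -/
lemma boxNorm_radial (c z : ℂ) (t : ℝ) : boxNorm (c + t * (z - c) - c) = |t| * boxNorm (z - c) := by
  rw [add_sub_cancel_left, boxNorm_ofReal_mul]

/-- The closure of the open square of positive half-side is the closed square. [folklore] -/
lemma closure_sqInt_eq {c : ℂ} {r : ℝ} (hr : 0 < r) : closure (sqInt c r) = sqSet c r := by
  refine (closure_minimal (sqInt_subset_sqSet c r) (isClosed_sqSet c r)).antisymm fun z hz ↦ ?_
  -- `z` is the limit of the points `c + (1 - 1/(n+1)) (z - c)` of the open square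
  have hlim : Tendsto (fun n : ℕ ↦ c + ((1 - 1 / ((n : ℝ) + 1) : ℝ) : ℂ) * (z - c)) atTop (𝓝 z) := by
    have h1 : Tendsto (fun n : ℕ ↦ (1 - 1 / ((n : ℝ) + 1) : ℝ)) atTop (𝓝 (1 - 0)) :=
      tendsto_const_nhds.sub tendsto_one_div_add_atTop_nhds_zero_nat
    have h2 : Tendsto (fun n : ℕ ↦ ((1 - 1 / ((n : ℝ) + 1) : ℝ) : ℂ)) atTop (𝓝 ((1 - 0 : ℝ) : ℂ)) :=
      (continuous_ofReal.tendsto _).comp h1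
    have h3 := tendsto_const_nhds (x := c).add (h2.mul (tendsto_const_nhds (x := z - c)))
    simpa using h3
  refine mem_closure_of_tendsto hlim (Eventually.of_forall fun n ↦ ?_)
  change boxNorm (c + ((1 - 1 / ((n : ℝ) + 1) : ℝ) : ℂ) * (z - c) - c) < r
  rw [boxNorm_radial]
  have hn : (0 : ℝ) < 1 / ((n : ℝ) + 1) := by positivity
  have hn' : 1 / ((n : ℝ) + 1) ≤ 1 := by
    rw [div_le_one (by positivity)]; linarith [n.cast_nonneg (α := ℝ)]
  rw [abs_of_nonneg (by linarith)]
  have hz' : boxNorm (z - c) ≤ r := hz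
  calc (1 - 1 / ((n : ℝ) + 1)) * boxNorm (z - c) ≤ (1 - 1 / ((n : ℝ) + 1)) * r :=
        mul_le_mul_of_nonneg_left hz' (by linarith)
    _ < r := by nlinarith

/-- If two open squares are disjoint and the first has positive half-side, then the first *closed*
square is disjoint from the second open square. [folklore] -/
lemma sqSet_inter_sqInt_eq_empty {c₁ c₂ : ℂ} {r₁ r₂ : ℝ} (hr₁ : 0 < r₁)
    (h : sqInt c₁ r₁ ∩ sqInt c₂ r₂ = ∅) : sqSet c₁ r₁ ∩ sqInt c₂ r₂ = ∅ := by
  rw [← closure_sqInt_eq hr₁]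
  have hd : Disjoint (sqInt c₁ r₁) (sqInt c₂ r₂) := disjoint_iff_inter_eq_empty.2 h
  exact disjoint_iff_inter_eq_empty.1 (hd.closure_left (isOpen_sqInt c₂ r₂))

/-- Points of the boundary of a square contained in an open set `U` are limits of points of `U`
outside the closed square. [folklore] -/
lemma sqBdry_subset_closure_diff {U : Set ℂ} (hU : IsOpen U) {c : ℂ} {r : ℝ} (hr : 0 < r)
    (hsub : sqSet c r ⊆ U) : sqBdry c r ⊆ closure (U \ sqSet c r) := by
  intro z hz
  have hzU : z ∈ U := hsub (sqBdry_subset_sqSet c r hz)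
  -- `z` is the limit of the points `c + (1 + 1/(n+1)) (z - c)` outside the square
  have hlim : Tendsto (fun n : ℕ ↦ c + ((1 + 1 / ((n : ℝ) + 1) : ℝ) : ℂ) * (z - c)) atTop (𝓝 z) := by
    have h1 : Tendsto (fun n : ℕ ↦ (1 + 1 / ((n : ℝ) + 1) : ℝ)) atTop (𝓝 (1 + 0)) :=
      tendsto_const_nhds.add tendsto_one_div_add_atTop_nhds_zero_nat
    have h2 : Tendsto (fun n : ℕ ↦ ((1 + 1 / ((n : ℝ) + 1) : ℝ) : ℂ)) atTop (𝓝 ((1 + 0 : ℝ) : ℂ)) :=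
      (continuous_ofReal.tendsto _).comp h1
    have h3 := tendsto_const_nhds (x := c).add (h2.mul (tendsto_const_nhds (x := z - c)))
    simpa using h3
  refine mem_closure_of_tendsto hlim ?_
  filter_upwards [hlim.eventually (hU.mem_nhds hzU)] with n hn
  refine ⟨hn, fun hmem ↦ ?_⟩
  have hmem' : boxNorm (c + ((1 + 1 / ((n : ℝ) + 1) : ℝ) : ℂ) * (z - c) - c) ≤ r := hmem
  rw [boxNorm_radial, mem_sqBdry.1 hz, abs_of_nonneg (by positivity)] at hmem'
  have : (0 : ℝ) < 1 / ((n : ℝ) + 1) := by positivity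
  nlinarith

/-- **A connected set meeting a closed square and its complement meets the boundary of the
square** (intermediate value theorem for the box distance to the centre). [folklore] -/
lemma exists_mem_sqBdry_of_isPreconnected {K : Set ℂ} (hK : IsPreconnected K) {c p q : ℂ} {r : ℝ}
    (hp : p ∈ K) (hpQ : p ∈ sqSet c r) (hq : q ∈ K) (hqQ : q ∉ sqSet c r) :
    ∃ z ∈ K, z ∈ sqBdry c r := by
  have hf : ContinuousOn (fun z ↦ boxNorm (z - c)) K :=
    (continuous_boxNorm.comp (continuous_id.sub continuous_const)).continuousOn
  obtain ⟨z, hzK, hz⟩ := hK.intermediate_value₂ hp hq hf continuousOn_const hpQ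
    (le_of_lt (not_le.1 hqQ))
  exact ⟨z, hzK, hz⟩

/-! ### The unit square loop -/

/-- The point `e^{iθ}` of the unit circle. [folklore] -/
lemma norm_circleMap_zero_one (θ : ℝ) : ‖circleMap 0 1 θ‖ = 1 := by
  simp [circleMap]

/-- The **unit square loop**: the radial projection `e^{iθ} / boxNorm (e^{iθ})` of the unit circle
onto the unit sphere of the box norm (the boundary of the square `[-1, 1]²`). [folklore] -/
def unitSquareLoop (θ : ℝ) : ℂ := ((boxNorm (circleMap 0 1 θ))⁻¹ : ℝ) * circleMap 0 1 θ

/-- The box norm of `e^{iθ}` is positive. [folklore] -/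
lemma boxNorm_circleMap_pos (θ : ℝ) : 0 < boxNorm (circleMap 0 1 θ) :=
  boxNorm_pos_of_norm_eq_one (norm_circleMap_zero_one θ)

/-- The unit square loop lies on the unit box sphere. [folklore] -/
@[simp] lemma boxNorm_unitSquareLoop (θ : ℝ) : boxNorm (unitSquareLoop θ) = 1 := by
  rw [unitSquareLoop, boxNorm_ofReal_mul, abs_of_pos (inv_pos.2 (boxNorm_circleMap_pos θ)),
    inv_mul_cancel₀ (boxNorm_circleMap_pos θ).ne']

/-- The unit square loop is continuous. [folklore] -/
@[fun_prop] lemma continuous_unitSquareLoop : Continuous unitSquareLoop := by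
  unfold unitSquareLoop
  refine (continuous_ofReal.comp ?_).mul (continuous_circleMap 0 1)
  exact (continuous_boxNorm.comp (continuous_circleMap 0 1)).inv₀
    fun θ ↦ (boxNorm_circleMap_pos θ).ne'

/-- The unit square loop is `2π`-periodic. [folklore] -/
lemma periodic_unitSquareLoop : Function.Periodic unitSquareLoop (2 * π) := fun θ ↦ by
  simp only [unitSquareLoop, periodic_circleMap 0 1 θ]

/-- The unit square loop is injective on one period. [folklore] -/
lemma injOn_unitSquareLoop : InjOn unitSquareLoop (Ico 0 (2 * π)) := by
  intro θ hθ θ' hθ' h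
  have key : circleMap 0 1 θ = circleMap 0 1 θ' := by
    have hn := congrArg (fun z : ℂ ↦ ‖z‖) h
    simp only [unitSquareLoop, Complex.norm_mul, norm_real, Real.norm_eq_abs,
      norm_circleMap_zero_one, mul_one, abs_inv] at hn
    rw [abs_of_pos (boxNorm_circleMap_pos θ), abs_of_pos (boxNorm_circleMap_pos θ')] at hn
    have hn' : boxNorm (circleMap 0 1 θ) = boxNorm (circleMap 0 1 θ') := inv_injective hn
    have h' := h
    simp only [unitSquareLoop, hn'] at h'
    exact mul_left_cancel₀ (by exact_mod_cast (inv_pos.2 (boxNorm_circleMap_pos θ')).ne') h'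
  exact injOn_circleMap_of_abs_sub_le' one_ne_zero (by linarith) hθ hθ' key

/-- Every point of the unit box sphere is on the unit square loop. [folklore] -/
lemma exists_unitSquareLoop_eq {z : ℂ} (hz : boxNorm z = 1) : ∃ θ, unitSquareLoop θ = z := by
  have hz0 : z ≠ 0 := by
    rintro rfl; simp at hz
  have hnorm : 0 < ‖z‖ := norm_pos_iff.2 hz0
  refine ⟨z.arg, ?_⟩
  have hcm : circleMap 0 1 z.arg = ((‖z‖⁻¹ : ℝ) : ℂ) * z := by
    rw [circleMap_zero, ofReal_one, one_mul]
    have h := norm_mul_exp_arg_mul_I z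
    symm
    calc ((‖z‖⁻¹ : ℝ) : ℂ) * z = ((‖z‖⁻¹ : ℝ) : ℂ) * (↑‖z‖ * cexp (↑z.arg * I)) := by rw [h]
      _ = cexp (↑z.arg * I) := by
        rw [← mul_assoc, ← ofReal_mul, inv_mul_cancel₀ hnorm.ne', ofReal_one, one_mul]
  rw [unitSquareLoop, hcm, boxNorm_ofReal_mul, hz, mul_one, abs_of_pos (inv_pos.2 hnorm), inv_inv,
    ← mul_assoc, ← ofReal_mul, mul_inv_cancel₀ hnorm.ne', ofReal_one, one_mul]

/-- The range of the unit square loop is the unit box sphere. [folklore] -/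
lemma range_unitSquareLoop : range unitSquareLoop = {z | boxNorm z = 1} :=
  Subset.antisymm (range_subset_iff.2 boxNorm_unitSquareLoop) fun _ hz ↦ exists_unitSquareLoop_eq hz

/-! ### The boundary loop of a square -/

/-- The boundary of the square of centre `c` and half-side `r`, parametrised by `[0, 1]` as
`t ↦ c + r · unitSquareLoop (2π t)` (a curve in the sense of Aizenman–Burchard 1999, §2.1). [folklore] -/
def squareLoop (c : ℂ) (r : ℝ) : Curve ℂ :=
  ⟨⟨fun t ↦ c + (r : ℂ) * unitSquareLoop (2 * π * t), by fun_prop⟩⟩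

/-- Pointwise formula for `squareLoop`. [folklore] -/
@[simp] lemma squareLoop_apply (c : ℂ) (r : ℝ) (t : unitInterval) :
    squareLoop c r t = c + (r : ℂ) * unitSquareLoop (2 * π * t) := rfl

/-- The square loop runs on the boundary of the square (`r ≥ 0`). [folklore] -/
lemma boxNorm_squareLoop_sub (c : ℂ) {r : ℝ} (hr : 0 ≤ r) (t : unitInterval) :
    boxNorm (squareLoop c r t - c) = r := by
  rw [squareLoop_apply, add_sub_cancel_left, boxNorm_ofReal_mul, boxNorm_unitSquareLoop, mul_one,
    abs_of_nonneg hr]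

/-- **The trace of the square loop is the boundary of the square** (`r > 0`). [folklore] -/
lemma range_squareLoop (c : ℂ) {r : ℝ} (hr : 0 < r) : (squareLoop c r).range = sqBdry c r := by
  refine Subset.antisymm ?_ fun z hz ↦ ?_
  · rintro _ ⟨t, rfl⟩
    exact boxNorm_squareLoop_sub c hr.le t
  · -- `z = c + r u` with `boxNorm u = 1`, `u = unitSquareLoop θ`, `θ ∈ [0, 2π)`
    have hu : boxNorm (((r⁻¹ : ℝ) : ℂ) * (z - c)) = 1 := by
      rw [boxNorm_ofReal_mul, mem_sqBdry.1 hz, abs_of_pos (inv_pos.2 hr), inv_mul_cancel₀ hr.ne']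
    obtain ⟨θ₀, hθ₀⟩ := exists_unitSquareLoop_eq hu
    obtain ⟨θ, hθmem, hθ⟩ := periodic_unitSquareLoop.exists_mem_Ico₀ (by positivity) θ₀
    refine ⟨⟨θ / (2 * π), ⟨div_nonneg hθmem.1 (by positivity), ?_⟩⟩, ?_⟩
    · rw [div_le_one (by positivity)]; exact hθmem.2.le
    · change c + (r : ℂ) * unitSquareLoop (2 * π * (θ / (2 * π))) = z
      rw [mul_div_cancel₀ _ (by positivity : (2 * π : ℝ) ≠ 0), ← hθ, hθ₀, ← mul_assoc,
        ← ofReal_mul, mul_inv_cancel₀ hr.ne', ofReal_one, one_mul, add_sub_cancel]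

/-- The trace of the square loop lies in the closed square (`r ≥ 0`). [folklore] -/
lemma range_squareLoop_subset_sqSet (c : ℂ) {r : ℝ} (hr : 0 ≤ r) :
    (squareLoop c r).range ⊆ sqSet c r := by
  rintro _ ⟨t, rfl⟩
  exact (boxNorm_squareLoop_sub c hr t).le

/-- The square loop is closed: it starts and ends at the same point. [folklore] -/
lemma isLoop_squareLoop (c : ℂ) (r : ℝ) : (squareLoop c r).IsLoop := by
  change squareLoop c r 0 = squareLoop c r 1
  simp only [squareLoop_apply, Set.Icc.coe_zero, Set.Icc.coe_one, mul_zero, mul_one]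
  rw [show (2 * π : ℝ) = 0 + 2 * π by ring, periodic_unitSquareLoop]

/-- **The square loop is a simple loop** (`r ≠ 0`): closed and injective on `[0, 1)`. [folklore] -/
lemma isSimpleLoop_squareLoop (c : ℂ) {r : ℝ} (hr : r ≠ 0) : (squareLoop c r).IsSimpleLoop := by
  refine ⟨isLoop_squareLoop c r, fun s hs t ht h ↦ ?_⟩
  simp only [squareLoop_apply, add_right_inj] at h
  have h' := mul_left_cancel₀ (by exact_mod_cast hr) h
  have hs' : (2 * π * (s : ℝ)) ∈ Ico 0 (2 * π) :=
    ⟨mul_nonneg (by positivity) s.2.1, by nlinarith [pi_pos, show (s : ℝ) < 1 from hs]⟩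
  have ht' : (2 * π * (t : ℝ)) ∈ Ico 0 (2 * π) :=
    ⟨mul_nonneg (by positivity) t.2.1, by nlinarith [pi_pos, show (t : ℝ) < 1 from ht]⟩
  have := injOn_unitSquareLoop hs' ht' h'
  exact Subtype.ext (mul_left_cancel₀ (by positivity : (2 * π : ℝ) ≠ 0) this)

/-- The class of the square loop is a simple loop of curve space. [folklore] -/
lemma mk_squareLoop_mem_simpleLoop (c : ℂ) {r : ℝ} (hr : r ≠ 0) :
    CurveClass.mk (squareLoop c r) ∈ (CurveClass.simpleLoop : Set (CurveClass ℂ)) :=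
  CurveClass.mk_mem_simpleLoop (isSimpleLoop_squareLoop c hr)

/-- A connected set containing a point of a closed square and a point outside it meets the trace
of the square loop. [folklore] -/
lemma exists_mem_range_squareLoop_of_isPreconnected {K : Set ℂ} (hK : IsPreconnected K)
    {c p q : ℂ} {r : ℝ} (hr : 0 < r) (hp : p ∈ K) (hpQ : p ∈ sqSet c r) (hq : q ∈ K)
    (hqQ : q ∉ sqSet c r) : (K ∩ (squareLoop c r).range).Nonempty := by
  obtain ⟨z, hzK, hz⟩ := exists_mem_sqBdry_of_isPreconnected hK hp hpQ hq hqQ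
  exact ⟨z, hzK, (range_squareLoop c hr).symm ▸ hz⟩

/-! ### Dyadic squares -/

/-- The centre `((a + 1/2) 2⁻ᵏ, (b + 1/2) 2⁻ᵏ)` of the dyadic square
`[a 2⁻ᵏ, (a+1) 2⁻ᵏ] × [b 2⁻ᵏ, (b+1) 2⁻ᵏ]`. [folklore] -/
def dyCenter (k : ℕ) (a b : ℤ) : ℂ := ⟨((a : ℝ) + 2⁻¹) / 2 ^ k, ((b : ℝ) + 2⁻¹) / 2 ^ k⟩

/-- The half-side `2⁻ᵏ⁻¹` of a dyadic square of level `k`. [folklore] -/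
def dyRad (k : ℕ) : ℝ := 2⁻¹ / 2 ^ k

/-- Real part of the dyadic centre. [folklore] -/
@[simp] lemma dyCenter_re (k : ℕ) (a b : ℤ) : (dyCenter k a b).re = ((a : ℝ) + 2⁻¹) / 2 ^ k := rfl

/-- Imaginary part of the dyadic centre. [folklore] -/
@[simp] lemma dyCenter_im (k : ℕ) (a b : ℤ) : (dyCenter k a b).im = ((b : ℝ) + 2⁻¹) / 2 ^ k := rfl

/-- The half-side of a dyadic square is positive. [folklore] -/
lemma dyRad_pos (k : ℕ) : 0 < dyRad k := by unfold dyRad; positivity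

/-- `dyRad k = 2⁻¹ (2ᵏ)⁻¹`. [folklore] -/
lemma dyRad_eq (k : ℕ) : dyRad k = 2⁻¹ * (2 ^ k)⁻¹ := by rw [dyRad, div_eq_mul_inv]

/-- The half-sides halve at each level. [folklore] -/
lemma dyRad_succ (k : ℕ) : dyRad (k + 1) = dyRad k / 2 := by
  rw [dyRad, dyRad, pow_succ]; ring

/-- The half-sides are at most `1/2`. [folklore] -/
lemma dyRad_le_half (k : ℕ) : dyRad k ≤ 2⁻¹ := by
  rw [dyRad_eq]
  exact mul_le_of_le_one_right (by norm_num) (inv_le_one_of_one_le₀ (one_le_pow₀ (by norm_num)))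

/-- The half-sides are antitone in the level. [folklore] -/
lemma dyRad_le_dyRad {k l : ℕ} (h : k ≤ l) : dyRad l ≤ dyRad k := by
  rw [dyRad_eq, dyRad_eq]
  exact mul_le_mul_of_nonneg_left (inv_anti₀ (by positivity) (pow_le_pow_right₀ (by norm_num) h))
    (by norm_num)

/-- The half-sides tend to zero. [folklore] -/
lemma tendsto_dyRad : Tendsto dyRad atTop (𝓝 0) := by
  have h : Tendsto (fun k : ℕ ↦ (2⁻¹ : ℝ) * (2⁻¹) ^ k) atTop (𝓝 (2⁻¹ * 0)) :=
    (tendsto_pow_atTop_nhds_zero_of_lt_one (by norm_num) (by norm_num)).const_mul _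
  rw [mul_zero] at h
  refine h.congr fun k ↦ ?_
  rw [dyRad_eq, inv_pow]

/-- For every `ε > 0` the dyadic half-sides are eventually `< ε`. [folklore] -/
lemma exists_dyRad_lt {ε : ℝ} (hε : 0 < ε) : ∃ k₀, ∀ k ≥ k₀, dyRad k < ε := by
  obtain ⟨k₀, hk₀⟩ := (tendsto_order.1 tendsto_dyRad).2 ε hε |>.exists_forall_of_atTop
  exact ⟨k₀, hk₀⟩

/-- Membership in a closed dyadic square, in coordinates. [folklore] -/
lemma mem_dySq_iff {k : ℕ} {a b : ℤ} {z : ℂ} :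
    z ∈ sqSet (dyCenter k a b) (dyRad k) ↔
      (a : ℝ) / 2 ^ k ≤ z.re ∧ z.re ≤ ((a : ℝ) + 1) / 2 ^ k ∧
        (b : ℝ) / 2 ^ k ≤ z.im ∧ z.im ≤ ((b : ℝ) + 1) / 2 ^ k := by
  rw [mem_sqSet_iff, abs_sub_le_iff, abs_sub_le_iff, dyCenter_re, dyCenter_im, dyRad]
  have e1 : ((a : ℝ) + 2⁻¹) / 2 ^ k - 2⁻¹ / 2 ^ k = a / 2 ^ k := by ring
  have e2 : ((a : ℝ) + 2⁻¹) / 2 ^ k + 2⁻¹ / 2 ^ k = (a + 1) / 2 ^ k := by ring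
  have e3 : ((b : ℝ) + 2⁻¹) / 2 ^ k - 2⁻¹ / 2 ^ k = b / 2 ^ k := by ring
  have e4 : ((b : ℝ) + 2⁻¹) / 2 ^ k + 2⁻¹ / 2 ^ k = (b + 1) / 2 ^ k := by ring
  constructor
  · rintro ⟨⟨h1, h2⟩, h3, h4⟩
    exact ⟨by linarith, by linarith, by linarith, by linarith⟩
  · rintro ⟨h1, h2, h3, h4⟩
    exact ⟨⟨by linarith, by linarith⟩, by linarith, by linarith⟩

/-- **Bridge**: the closed dyadic square in centre/half-side form is the tree's `dyadicSquare`
(`RestrictionConfigEvents.lean`). [folklore] -/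
lemma sqSet_dyCenter_dyRad_eq (k : ℕ) (a b : ℤ) : sqSet (dyCenter k a b) (dyRad k) = dyadicSquare k a b :=
  Set.ext fun _ ↦ mem_dySq_iff

/-- Membership in an open dyadic square, in coordinates. [folklore] -/
lemma mem_dySqInt_iff {k : ℕ} {a b : ℤ} {z : ℂ} :
    z ∈ sqInt (dyCenter k a b) (dyRad k) ↔
      (a : ℝ) / 2 ^ k < z.re ∧ z.re < ((a : ℝ) + 1) / 2 ^ k ∧
        (b : ℝ) / 2 ^ k < z.im ∧ z.im < ((b : ℝ) + 1) / 2 ^ k := by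
  rw [mem_sqInt_iff, abs_sub_lt_iff, abs_sub_lt_iff, dyCenter_re, dyCenter_im, dyRad]
  have e1 : ((a : ℝ) + 2⁻¹) / 2 ^ k - 2⁻¹ / 2 ^ k = a / 2 ^ k := by ring
  have e2 : ((a : ℝ) + 2⁻¹) / 2 ^ k + 2⁻¹ / 2 ^ k = (a + 1) / 2 ^ k := by ring
  have e3 : ((b : ℝ) + 2⁻¹) / 2 ^ k - 2⁻¹ / 2 ^ k = b / 2 ^ k := by ring
  have e4 : ((b : ℝ) + 2⁻¹) / 2 ^ k + 2⁻¹ / 2 ^ k = (b + 1) / 2 ^ k := by ring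
  constructor
  · rintro ⟨⟨h1, h2⟩, h3, h4⟩
    exact ⟨by linarith, by linarith, by linarith, by linarith⟩
  · rintro ⟨h1, h2, h3, h4⟩
    exact ⟨⟨by linarith, by linarith⟩, by linarith, by linarith⟩

/-- The interior of a closed square of positive half-side is the open square. [folklore] -/
lemma interior_sqSet_eq {c : ℂ} {r : ℝ} (hr : 0 < r) : interior (sqSet c r) = sqInt c r := by
  refine Subset.antisymm (fun z hz ↦ ?_) (interior_maximal (sqInt_subset_sqSet c r) (isOpen_sqInt c r))
  by_contra hz'
  have hb : z ∈ sqBdry c r :=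
    mem_sqBdry_of_mem_sqSet_of_not_mem_sqInt (interior_subset hz) hz'
  have hcl : z ∈ closure (univ \ sqSet c r) :=
    sqBdry_subset_closure_diff isOpen_univ hr (subset_univ _) hb
  rw [← compl_eq_univ_sdiff, closure_compl] at hcl
  exact hcl hz

/-- Nested closed squares have nested open squares (positive half-sides). [folklore] -/
lemma sqInt_subset_sqInt_of_subset {c₁ c₂ : ℂ} {r₁ r₂ : ℝ} (hr₁ : 0 < r₁) (hr₂ : 0 < r₂)
    (h : sqSet c₁ r₁ ⊆ sqSet c₂ r₂) : sqInt c₁ r₁ ⊆ sqInt c₂ r₂ := by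
  rw [← interior_sqSet_eq hr₁, ← interior_sqSet_eq hr₂]
  exact interior_mono h

/-- The boundary of a square misses the open square of any closed square it contains. [folklore] -/
lemma sqBdry_inter_sqInt_eq_empty_of_subset {c₁ c₂ : ℂ} {r₁ r₂ : ℝ} (hr₁ : 0 < r₁) (hr₂ : 0 < r₂)
    (h : sqSet c₂ r₂ ⊆ sqSet c₁ r₁) : sqBdry c₁ r₁ ∩ sqInt c₂ r₂ = ∅ := by
  have h' := sqInt_subset_sqInt_of_subset hr₂ hr₁ h
  refine eq_empty_of_forall_notMem fun z ⟨hz1, hz2⟩ ↦ ?_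
  have : z ∈ sqInt c₁ r₁ ∩ sqBdry c₁ r₁ := ⟨h' hz2, hz1⟩
  rw [sqInt_inter_sqBdry] at this
  exact this

/-- One coordinate of the nesting of dyadic squares: if the open dyadic intervals
`(a 2⁻ᵏ, (a+1) 2⁻ᵏ)` and `(a' 2⁻ᵏ', (a'+1) 2⁻ᵏ')`, `k ≤ k'`, share a point, then the finer closed
interval lies in the coarser one. [folklore] -/
lemma dyadic_coord_nested {k k' : ℕ} (h : k ≤ k') {a a' : ℤ} {x : ℝ}
    (h1 : (a : ℝ) / 2 ^ k < x) (h2 : x < ((a : ℝ) + 1) / 2 ^ k)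
    (h3 : (a' : ℝ) / 2 ^ k' < x) (h4 : x < ((a' : ℝ) + 1) / 2 ^ k') {y : ℝ}
    (hy1 : (a' : ℝ) / 2 ^ k' ≤ y) (hy2 : y ≤ ((a' : ℝ) + 1) / 2 ^ k') :
    (a : ℝ) / 2 ^ k ≤ y ∧ y ≤ ((a : ℝ) + 1) / 2 ^ k := by
  obtain ⟨d, rfl⟩ := Nat.exists_eq_add_of_le h
  have hP : (0 : ℝ) < 2 ^ k := by positivity
  have hM : (0 : ℝ) < 2 ^ d := by positivity
  have hPM : (2 : ℝ) ^ (k + d) = 2 ^ k * 2 ^ d := pow_add _ _ _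
  rw [hPM] at h3 h4 hy1 hy2
  have hPM0 : (0 : ℝ) < 2 ^ k * 2 ^ d := by positivity
  have h1' : (a : ℝ) < x * 2 ^ k := (div_lt_iff₀ hP).1 h1
  have h2' : x * 2 ^ k < a + 1 := (lt_div_iff₀ hP).1 h2
  have h3' : (a' : ℝ) < x * (2 ^ k * 2 ^ d) := (div_lt_iff₀ hPM0).1 h3
  have h4' : x * (2 ^ k * 2 ^ d) < a' + 1 := (lt_div_iff₀ hPM0).1 h4
  -- integer consequences
  have i1 : a * 2 ^ d ≤ a' := by
    have : (a : ℝ) * 2 ^ d < a' + 1 :=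
      calc (a : ℝ) * 2 ^ d < x * 2 ^ k * 2 ^ d := mul_lt_mul_of_pos_right h1' hM
        _ = x * (2 ^ k * 2 ^ d) := by ring
        _ < a' + 1 := h4'
    have : (a * 2 ^ d : ℤ) < a' + 1 := by exact_mod_cast this
    omega
  have i2 : a' + 1 ≤ (a + 1) * 2 ^ d := by
    have : (a' : ℝ) < (a + 1) * 2 ^ d :=
      calc (a' : ℝ) < x * (2 ^ k * 2 ^ d) := h3'
        _ = x * 2 ^ k * 2 ^ d := by ring
        _ < (a + 1) * 2 ^ d := mul_lt_mul_of_pos_right h2' hM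
    have : (a' : ℤ) < (a + 1) * 2 ^ d := by exact_mod_cast this
    omega
  have i1' : (a : ℝ) * 2 ^ d ≤ a' := by exact_mod_cast i1
  have i2' : (a' : ℝ) + 1 ≤ (a + 1) * 2 ^ d := by exact_mod_cast i2
  have hy1' : (a' : ℝ) ≤ y * (2 ^ k * 2 ^ d) := (div_le_iff₀ hPM0).1 hy1
  have hy2' : y * (2 ^ k * 2 ^ d) ≤ a' + 1 := (le_div_iff₀ hPM0).1 hy2
  constructor
  · rw [div_le_iff₀ hP]
    have : (a : ℝ) * 2 ^ d ≤ y * 2 ^ k * 2 ^ d := by nlinarith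
    exact le_of_mul_le_mul_right this hM
  · rw [le_div_iff₀ hP]
    have : y * 2 ^ k * 2 ^ d ≤ (a + 1) * 2 ^ d := by nlinarith
    exact le_of_mul_le_mul_right this hM

/-- If the open dyadic squares of levels `k ≤ k'` share a point, the finer closed square lies in
the coarser one. [folklore] -/
lemma dySq_subset_of_mem_sqInt {k k' : ℕ} (h : k ≤ k') {a b a' b' : ℤ} {z : ℂ}
    (hz : z ∈ sqInt (dyCenter k a b) (dyRad k)) (hz' : z ∈ sqInt (dyCenter k' a' b') (dyRad k')) :
    sqSet (dyCenter k' a' b') (dyRad k') ⊆ sqSet (dyCenter k a b) (dyRad k) := by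
  rw [mem_dySqInt_iff] at hz hz'
  intro w hw
  rw [mem_dySq_iff] at hw ⊢
  obtain ⟨hx1, hx2⟩ := dyadic_coord_nested h hz.1 hz.2.1 hz'.1 hz'.2.1 hw.1 hw.2.1
  obtain ⟨hy1, hy2⟩ := dyadic_coord_nested h hz.2.2.1 hz.2.2.2 hz'.2.2.1 hz'.2.2.2 hw.2.2.1 hw.2.2.2
  exact ⟨hx1, hx2, hy1, hy2⟩

/-- **Dyadic trichotomy**: two dyadic squares are nested (one way or the other) or their open
squares are disjoint. [folklore] -/
lemma dySq_trichotomy (k k' : ℕ) (a b a' b' : ℤ) :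
    sqSet (dyCenter k a b) (dyRad k) ⊆ sqSet (dyCenter k' a' b') (dyRad k') ∨
      sqSet (dyCenter k' a' b') (dyRad k') ⊆ sqSet (dyCenter k a b) (dyRad k) ∨
        sqInt (dyCenter k a b) (dyRad k) ∩ sqInt (dyCenter k' a' b') (dyRad k') = ∅ := by
  by_cases hne : (sqInt (dyCenter k a b) (dyRad k) ∩ sqInt (dyCenter k' a' b') (dyRad k')).Nonempty
  · obtain ⟨z, hz, hz'⟩ := hne
    rcases le_total k k' with h | h
    · exact Or.inr (Or.inl (dySq_subset_of_mem_sqInt h hz hz'))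
    · exact Or.inl (dySq_subset_of_mem_sqInt h hz' hz)
  · exact Or.inr (Or.inr (not_nonempty_iff_eq_empty.1 hne))

/-- The dyadic square of level `k` containing a point (`mem_dyadicSquare_floor` through the bridge). [folklore] -/
lemma mem_dySq_floor (k : ℕ) (p : ℂ) :
    p ∈ sqSet (dyCenter k ⌊(2 : ℝ) ^ k * p.re⌋ ⌊(2 : ℝ) ^ k * p.im⌋) (dyRad k) := by
  rw [sqSet_dyCenter_dyRad_eq]
  exact mem_dyadicSquare_floor p k

/-- **Every point of an open set lies in dyadic squares of all sufficiently fine levels contained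
in the set.** [folklore] -/
lemma exists_dySq_subset {U : Set ℂ} (hU : IsOpen U) {p : ℂ} (hp : p ∈ U) :
    ∃ k₀, ∀ k ≥ k₀, ∃ a b : ℤ,
      p ∈ sqSet (dyCenter k a b) (dyRad k) ∧ sqSet (dyCenter k a b) (dyRad k) ⊆ U := by
  obtain ⟨ε, hε, hball⟩ := Metric.isOpen_iff.1 hU p hp
  obtain ⟨k₀, hk₀⟩ := exists_dyRad_lt (show 0 < ε / 4 by positivity)
  refine ⟨k₀, fun k hk ↦ ⟨⌊(2 : ℝ) ^ k * p.re⌋, ⌊(2 : ℝ) ^ k * p.im⌋, mem_dySq_floor k p, fun z hz ↦ hball ?_⟩⟩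
  rw [Metric.mem_ball]
  calc dist z p ≤ 4 * dyRad k := dist_le_of_mem_sqSet hz (mem_dySq_floor k p)
    _ < ε := by linarith [hk₀ k hk]

/-- The complement of a square, in coordinates. [folklore] -/
lemma not_mem_sqSet_iff {c z : ℂ} {r : ℝ} :
    z ∉ sqSet c r ↔ z.re < c.re - r ∨ c.re + r < z.re ∨ z.im < c.im - r ∨ c.im + r < z.im := by
  rw [mem_sqSet_iff, abs_sub_le_iff, abs_sub_le_iff]
  constructor
  · intro h
    by_contra h'
    simp only [not_or, not_lt] at h'
    exact h ⟨⟨by linarith, by linarith⟩, by linarith, by linarith⟩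
  · rintro (h | h | h | h) ⟨⟨h1, h2⟩, h3, h4⟩ <;> linarith

/-- **The open upper half-plane minus a closed square lying strictly above the real axis is
connected**: it is the union of four convex pieces (left, right, above, below the square), each
meeting the next. [folklore] -/
lemma isPreconnected_upperHalfPlane_diff_sqSet {c : ℂ} {r : ℝ} (hr : 0 ≤ r) (h : r < c.im) :
    IsPreconnected ({z : ℂ | 0 < z.im} \ sqSet c r) := by
  set A₁ : Set ℂ := {z : ℂ | 0 < z.im} ∩ {z | z.re < c.re - r} with hA₁
  set A₂ : Set ℂ := {z : ℂ | 0 < z.im} ∩ {z | c.re + r < z.re} with hA₂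
  set A₃ : Set ℂ := {z : ℂ | c.im + r < z.im} with hA₃
  set A₄ : Set ℂ := {z : ℂ | 0 < z.im} ∩ {z | z.im < c.im - r} with hA₄
  have hc₁ : IsPreconnected A₁ := ((convex_halfSpace_im_gt _).inter (convex_halfSpace_re_lt _)).isPreconnected
  have hc₂ : IsPreconnected A₂ := ((convex_halfSpace_im_gt _).inter (convex_halfSpace_re_gt _)).isPreconnected
  have hc₃ : IsPreconnected A₃ := (convex_halfSpace_im_gt _).isPreconnected
  have hc₄ : IsPreconnected A₄ := ((convex_halfSpace_im_gt _).inter (convex_halfSpace_im_lt _)).isPreconnected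
  have heq : {z : ℂ | 0 < z.im} \ sqSet c r = ((A₁ ∪ A₃) ∪ A₂) ∪ A₄ := by
    ext z
    rw [Set.mem_sdiff, not_mem_sqSet_iff]
    simp only [mem_setOf_eq, mem_union, hA₁, hA₂, hA₃, hA₄, mem_inter_iff]
    constructor
    · rintro ⟨hz, h1 | h1 | h1 | h1⟩
      · exact Or.inl (Or.inl (Or.inl ⟨hz, h1⟩))
      · exact Or.inl (Or.inr ⟨hz, h1⟩)
      · exact Or.inr ⟨hz, h1⟩
      · exact Or.inl (Or.inl (Or.inr h1))
    · rintro (((⟨hz, h1⟩ | h1) | ⟨hz, h1⟩) | ⟨hz, h1⟩)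
      · exact ⟨hz, Or.inl h1⟩
      · exact ⟨by linarith, Or.inr (Or.inr (Or.inr h1))⟩
      · exact ⟨hz, Or.inr (Or.inl h1)⟩
      · exact ⟨hz, Or.inr (Or.inr (Or.inl h1))⟩
  rw [heq]
  -- glue the pieces at explicit common points
  have p₁ : (⟨c.re - r - 1, c.im + r + 1⟩ : ℂ) ∈ A₁ := ⟨by change (0:ℝ) < c.im + r + 1; linarith,
    by change c.re - r - 1 < c.re - r; linarith⟩
  have p₁' : (⟨c.re - r - 1, c.im + r + 1⟩ : ℂ) ∈ A₃ := by change c.im + r < c.im + r + 1; linarith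
  have p₂ : (⟨c.re + r + 1, c.im + r + 1⟩ : ℂ) ∈ A₃ := by change c.im + r < c.im + r + 1; linarith
  have p₂' : (⟨c.re + r + 1, c.im + r + 1⟩ : ℂ) ∈ A₂ := ⟨by change (0:ℝ) < c.im + r + 1; linarith,
    by change c.re + r < c.re + r + 1; linarith⟩
  have p₃ : (⟨c.re - r - 1, (c.im - r) / 2⟩ : ℂ) ∈ A₁ := ⟨by change (0:ℝ) < (c.im - r) / 2; linarith,
    by change c.re - r - 1 < c.re - r; linarith⟩
  have p₃' : (⟨c.re - r - 1, (c.im - r) / 2⟩ : ℂ) ∈ A₄ := ⟨by change (0:ℝ) < (c.im - r) / 2; linarith,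
    by change (c.im - r) / 2 < c.im - r; linarith⟩
  have h13 : IsPreconnected (A₁ ∪ A₃) := hc₁.union _ p₁ p₁' hc₃
  have h132 : IsPreconnected ((A₁ ∪ A₃) ∪ A₂) := h13.union _ (Or.inr p₂) p₂' hc₂
  exact h132.union _ (Or.inl (Or.inl p₃)) p₃' hc₄

end Literature.Probability.RandomPlanarGeometry
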